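/-
Copyright: the b2b-balaban cell (near-miss cell 7), T⁴-continuum CRUX team (coordinator ruling e34b3e0c item (2)),
seat t4-ne7b-formalise-leaf-06 (gen 26). Released under the licence of the surrounding project.
-/
import Summits.QuantumFields.BalabanUV.T4Continuum.Spine.NE7b.LocalPlaquetteExpMoments
import HarnessLib

/-!
# Local exponential plaquette moments, all orientation classes; the mean plaquette energy is `O(1/β)`
# (route NE7b R-T1, rung 0 = prediction P1-a of `t4/ROUTES-NE7b.md`) — corollaries

Cell `pub-balaban`, sub-cell `t4`, spine estimate NE7b (node U5c), candidate route R-T1 of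
`t4/ROUTES-NE7b.md` v1. The sibling module `…Spine.NE7b.LocalPlaquetteExpMoments` proves P1-a for the
plaquettes of ONE orientation class (`localExpMoment_class`: `E_β[exp(aβ∑_{x∈Q}A_{(x,o)})] ≤ e^{C a #Q}`,
`0 ≤ a ≤ ½`, `β ≥ 4`, all odd tori `(ℤ/(2S+1))⁴`, `S ≥ 1`). Here:

* `localExpMoment` — ARBITRARY finite plaquette sets `X`: `E_β[exp(aβ∑_{p∈X}A_p)] ≤ e^{C a #X}` for
  `0 ≤ a ≤ 1/12` (Jensen for `exp` over the six orientation classes, then the class bound at `6a ≤ ½`);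
* `integral_plaqEnergy_le_div` — the MEAN PLAQUETTE ENERGY `E_β[N − Re tr r(U_p)] ≤ C'/β` for every
  plaquette, every `β ≥ 4`, uniformly in the (odd) volume (`1 + y ≤ e^y` in the class bound at `a = ½`):
  the equipartition-type UPPER bound at weak coupling, with no expansion.

Everything is proved (kernel; no hypothesis, no `def`). HONEST FRAMING: rung 0 of (LS) only (bare
measure); (LS) at scales `j ≥ 1` untouched; NE7b (`T4WeightBudget.RelWeightBound`) NOT PRINTED in
[Bałaban 1983–89] and NOT PROVED; spine PROVED 0∕9; rung (B)+1 on a FINITE torus T⁴ — NOT infinite volume,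
NOT the mass gap, NOT Clay. HONEST DEPENDENCY: continuum YM on T⁴ ⇐ BetaPertH ∧ nine spine estimates
(0/9 proved); BetaPertH ⇐ (D1) ∧ (D4) ∧ CAP+tail; G-an2-4 gates asym, D1 and NE2/3/4.
-/

set_option autoImplicit false

noncomputable section

namespace Summit.QuantumFields.BalabanUV.T4Continuum.NE7b.LocalPlaquetteExpMoments

open scoped BigOperators
open MeasureTheory
open Literature.MathematicalPhysics.QuantumFieldTheory

variable {G : Type} [Group G] [TopologicalSpace G] [IsTopologicalGroup G] [CompactSpace G]
  [MeasurableSpace G] [BorelSpace G]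

section All


omit [Group G] [TopologicalSpace G] [IsTopologicalGroup G] [CompactSpace G] [MeasurableSpace G]
  [BorelSpace G] in
/-- `#(Finset.univ.filter fun x => (x, o) ∈ X) ≤ #X` (`x ↦ (x, o)` is injective into `X`). -/
theorem card_classSites_le {L : ℕ} [NeZero L] (X : Finset (Plaquette 4 L)) (o : {q : Fin 4 × Fin 4 // q.1 < q.2}) :
    (Finset.univ.filter fun x => (x, o) ∈ X).card ≤ X.card := by
  refine Finset.card_le_card_of_injOn (fun x => (x, o)) (fun x hx => ?_) fun x _ y _ h => ?_
  · simpa using hx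
  · simpa using congrArg Prod.fst h

omit [Group G] [TopologicalSpace G] [IsTopologicalGroup G] [CompactSpace G] [MeasurableSpace G]
  [BorelSpace G] in
/-- A sum over a plaquette set splits into its orientation classes. -/
theorem sum_plaquette_eq_sum_class {L : ℕ} [NeZero L] (X : Finset (Plaquette 4 L)) (f : Plaquette 4 L → ℝ) :
    ∑ p ∈ X, f p = ∑ o : {q : Fin 4 × Fin 4 // q.1 < q.2}, ∑ x ∈ (Finset.univ.filter fun x => (x, o) ∈ X), f (x, o) := by
  have h : ∀ o : {q : Fin 4 × Fin 4 // q.1 < q.2}, ∑ x ∈ (Finset.univ.filter fun x => (x, o) ∈ X), f (x, o) =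
      ∑ x : Site 4 L, if (x, o) ∈ X then f (x, o) else 0 := fun o => by
    rw [Finset.sum_filter]
  simp_rw [h]
  rw [Finset.sum_comm]
  have h2 : ∑ p ∈ X, f p = ∑ p : Plaquette 4 L, if p ∈ X then f p else 0 := by
    rw [Finset.sum_ite_mem, Finset.univ_inter]
  rw [h2, Fintype.sum_prod_type]

/-- **LOCAL EXPONENTIAL PLAQUETTE MOMENTS, ARBITRARY PLAQUETTE SETS (P1-a of route NE7b R-T1).** For a
faithful continuous unitary lattice representation `r` of a compact group `G` there is `C ≥ 0` such that
for every odd torus `(ℤ/(2S+1))⁴` with `S ≥ 1`, every `β ≥ 4`, every `0 ≤ a ≤ 1/12` and every finite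
set `X` of plaquettes:
`∫ exp(a·β·∑_{p∈X} (N − Re tr r(U_p))) dμ_β ≤ exp(C·a·#X)`
(Jensen over the six orientation classes, then `localExpMoment_class` at `6a ≤ ½`). -/
theorem localExpMoment (r : LatticeRep G) :
    ∃ C : ℝ, 0 ≤ C ∧ ∀ (S : ℕ), 1 ≤ S → ∀ (β : ℝ), 4 ≤ β → ∀ (a : ℝ), 0 ≤ a → a ≤ 1 / 12 →
      ∀ (X : Finset (Plaquette 4 (2 * S + 1))),
        ∫ U, Real.exp (a * β * ∑ p ∈ X, ((r.N : ℝ) - WilsonRP.plaqRe r.ρ U p))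
            ∂(wilsonMeasure r.ρ β : Measure (GaugeConfig 4 (2 * S + 1) G)) ≤
          Real.exp (C * a * X.card) := by
  obtain ⟨C, hC0, hC⟩ := localExpMoment_class r
  refine ⟨6 * C, by positivity, fun S hS β hβ a ha0 ha X => ?_⟩
  haveI hprob := isProbabilityMeasure_wilsonMeasure (d := 4) (L := 2 * S + 1) (G := G) r.ρ r.continuous β
  -- there are six orientation classes (the tree's `CurvatureBoostCovariance.Negative.card_planes`; re-derived
  -- locally by `decide` to keep the import cone small)
  have card_orient : Fintype.card {q : Fin 4 × Fin 4 // q.1 < q.2} = 6 := by decide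
  set μ : Measure (GaugeConfig 4 (2 * S + 1) G) := wilsonMeasure r.ρ β with hμ
  have hβ0 : 0 ≤ β := by linarith
  -- the class observables
  set E : {q : Fin 4 × Fin 4 // q.1 < q.2} → GaugeConfig 4 (2 * S + 1) G → ℝ :=
    fun o U => ∑ x ∈ (Finset.univ.filter fun x => (x, o) ∈ X), ((r.N : ℝ) - WilsonRP.plaqRe r.ρ U (x, o)) with hE
  -- Jensen for `exp` over the six classes, pointwise
  have hJ : ∀ U : GaugeConfig 4 (2 * S + 1) G,
      Real.exp (a * β * ∑ p ∈ X, ((r.N : ℝ) - WilsonRP.plaqRe r.ρ U p)) ≤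
        ∑ o : {q : Fin 4 × Fin 4 // q.1 < q.2}, (1 / 6 : ℝ) * Real.exp (6 * a * β * E o U) := by
    intro U
    have hsplit : a * β * ∑ p ∈ X, ((r.N : ℝ) - WilsonRP.plaqRe r.ρ U p) =
        ∑ o : {q : Fin 4 × Fin 4 // q.1 < q.2}, (1 / 6 : ℝ) • (6 * a * β * E o U) := by
      rw [sum_plaquette_eq_sum_class X, Finset.mul_sum]
      refine Finset.sum_congr rfl fun o _ => ?_
      simp only [hE, smul_eq_mul]
      ring
    have hj := (convexOn_exp.map_sum_le (t := (Finset.univ : Finset {q : Fin 4 × Fin 4 // q.1 < q.2})) (w := fun _ => (1 / 6 : ℝ))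
      (p := fun o => 6 * a * β * E o U) (fun _ _ => by norm_num)
      (by rw [Finset.sum_const, Finset.card_univ, card_orient]; norm_num) (fun _ _ => Set.mem_univ _))
    rw [hsplit]
    simpa only [smul_eq_mul] using hj
  -- integrate
  have hint : ∀ o : {q : Fin 4 × Fin 4 // q.1 < q.2}, Integrable (fun U => (1 / 6 : ℝ) * Real.exp (6 * a * β * E o U)) μ := by
    intro o
    refine (integrable_exp_of_abs_le r.ρ r.continuous β
      (measurable_mul_sum_plaqEnergy r.ρ r.continuous (6 * a * β) o (Finset.univ.filter fun x => (x, o) ∈ X))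
      (B := |6 * a * β| * (2 * r.N * (Finset.univ.filter fun x => (x, o) ∈ X).card)) fun U => ?_).const_mul _
    rw [abs_mul]
    exact mul_le_mul_of_nonneg_left (abs_sum_plaqEnergy_le r.ρ r.continuous o _ U) (abs_nonneg _)
  have hLint : Integrable (fun U => Real.exp (a * β * ∑ p ∈ X, ((r.N : ℝ) - WilsonRP.plaqRe r.ρ U p))) μ := by
    refine integrable_exp_of_abs_le r.ρ r.continuous β
      ((Finset.measurable_sum X fun p _ =>
        measurable_const.sub (WilsonRP.measurable_plaqRe r.ρ r.continuous p)).const_mul (a * β))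
      (B := |a * β| * (2 * r.N * X.card)) fun U => ?_
    rw [abs_mul]
    refine mul_le_mul_of_nonneg_left ?_ (abs_nonneg _)
    rw [abs_of_nonneg (Finset.sum_nonneg fun p _ => plaqEnergy_nonneg r.ρ r.continuous U p)]
    calc ∑ p ∈ X, ((r.N : ℝ) - WilsonRP.plaqRe r.ρ U p) ≤ ∑ _p ∈ X, (2 * (r.N : ℝ)) :=
          Finset.sum_le_sum fun p _ => plaqEnergy_le r.ρ r.continuous U p
      _ = 2 * r.N * X.card := by rw [Finset.sum_const, nsmul_eq_mul]; ring
  have h6a : 6 * a ≤ 1 / 2 := by linarith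
  have h6a0 : 0 ≤ 6 * a := by linarith
  calc ∫ U, Real.exp (a * β * ∑ p ∈ X, ((r.N : ℝ) - WilsonRP.plaqRe r.ρ U p)) ∂μ
      ≤ ∫ U, ∑ o : {q : Fin 4 × Fin 4 // q.1 < q.2}, (1 / 6 : ℝ) * Real.exp (6 * a * β * E o U) ∂μ :=
        integral_mono hLint (integrable_finsetSum _ fun o _ => hint o) hJ
    _ = ∑ o : {q : Fin 4 × Fin 4 // q.1 < q.2}, (1 / 6 : ℝ) * ∫ U, Real.exp (6 * a * β * E o U) ∂μ := by
        rw [integral_finsetSum _ fun o _ => hint o]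
        refine Finset.sum_congr rfl fun o _ => ?_
        rw [integral_const_mul]
    _ ≤ ∑ _o : {q : Fin 4 × Fin 4 // q.1 < q.2}, (1 / 6 : ℝ) * Real.exp (6 * C * a * X.card) := by
        refine Finset.sum_le_sum fun o _ => mul_le_mul_of_nonneg_left ?_ (by norm_num)
        have h := hC S hS β hβ (6 * a) h6a0 h6a o (Finset.univ.filter fun x => (x, o) ∈ X)
        have h' : ∫ U, Real.exp (6 * a * β * E o U) ∂μ ≤ Real.exp (C * (6 * a) * (Finset.univ.filter fun x => (x, o) ∈ X).card) := by
          simpa only [hE] using h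
        refine h'.trans (Real.exp_le_exp.2 ?_)
        have hc : ((Finset.univ.filter fun x => (x, o) ∈ X).card : ℝ) ≤ X.card := by exact_mod_cast card_classSites_le X o
        calc C * (6 * a) * ((Finset.univ.filter fun x => (x, o) ∈ X).card : ℝ) ≤ C * (6 * a) * X.card :=
              mul_le_mul_of_nonneg_left hc (by positivity)
          _ = 6 * C * a * X.card := by ring
    _ = Real.exp (6 * C * a * X.card) := by
        rw [Finset.sum_const, Finset.card_univ, card_orient, nsmul_eq_mul]
        ring

/-- **THE MEAN PLAQUETTE ENERGY IS `O(1/β)` UNIFORMLY IN THE VOLUME.** For a faithful continuous unitary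
lattice representation `r` of a compact group `G` there is `C'` such that for every odd torus
`(ℤ/(2S+1))⁴` with `S ≥ 1`, every `β ≥ 4` and every plaquette `p`:
`∫ (N − Re tr r(U_p)) dμ_β ≤ C'/β` (from `localExpMoment_class` at `a = ½`, `Q = {x}`, and
`1 + y ≤ e^y`). -/
theorem integral_plaqEnergy_le_div (r : LatticeRep G) :
    ∃ C' : ℝ, 0 ≤ C' ∧ ∀ (S : ℕ), 1 ≤ S → ∀ (β : ℝ), 4 ≤ β → ∀ (p : Plaquette 4 (2 * S + 1)),
      ∫ U, ((r.N : ℝ) - WilsonRP.plaqRe r.ρ U p)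
          ∂(wilsonMeasure r.ρ β : Measure (GaugeConfig 4 (2 * S + 1) G)) ≤ C' / β := by
  obtain ⟨C, hC0, hC⟩ := localExpMoment_class r
  refine ⟨2 * (Real.exp (C / 2) - 1), by nlinarith [Real.add_one_le_exp (C / 2)],
    fun S hS β hβ p => ?_⟩
  haveI hprob := isProbabilityMeasure_wilsonMeasure (d := 4) (L := 2 * S + 1) (G := G) r.ρ r.continuous β
  set μ : Measure (GaugeConfig 4 (2 * S + 1) G) := wilsonMeasure r.ρ β with hμ
  have hβpos : 0 < β := by linarith
  obtain ⟨x, o⟩ := p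
  have h := hC S hS β hβ (1 / 2) (by norm_num) le_rfl o {x}
  simp only [Finset.sum_singleton, Finset.card_singleton, Nat.cast_one, mul_one] at h
  -- `1 + (β/2)·A ≤ exp((β/2)·A)` integrated
  have hAint : Integrable (fun U => (r.N : ℝ) - WilsonRP.plaqRe r.ρ U (x, o)) μ := by
    refine Integrable.of_bound
      (measurable_const.sub (WilsonRP.measurable_plaqRe r.ρ r.continuous (x, o))).aestronglyMeasurable
      (2 * r.N) (ae_of_all _ fun U => ?_)
    rw [Real.norm_eq_abs, abs_of_nonneg (plaqEnergy_nonneg r.ρ r.continuous U (x, o))]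
    exact plaqEnergy_le r.ρ r.continuous U (x, o)
  have hEint : Integrable (fun U => Real.exp (1 / 2 * β * ((r.N : ℝ) - WilsonRP.plaqRe r.ρ U (x, o)))) μ := by
    refine integrable_exp_of_abs_le r.ρ r.continuous β
      ((measurable_const.sub (WilsonRP.measurable_plaqRe r.ρ r.continuous (x, o))).const_mul _)
      (B := |1 / 2 * β| * (2 * r.N)) fun U => ?_
    rw [abs_mul, abs_of_nonneg (plaqEnergy_nonneg r.ρ r.continuous U (x, o))]
    exact mul_le_mul_of_nonneg_left (plaqEnergy_le r.ρ r.continuous U (x, o)) (abs_nonneg _)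
  have hf : Integrable (fun U => (1 : ℝ) + 1 / 2 * β * ((r.N : ℝ) - WilsonRP.plaqRe r.ρ U (x, o))) μ :=
    (integrable_const _).add (hAint.const_mul _)
  have hle : ∫ U, (1 + 1 / 2 * β * ((r.N : ℝ) - WilsonRP.plaqRe r.ρ U (x, o))) ∂μ ≤
      Real.exp (C * (1 / 2)) :=
    (integral_mono hf hEint fun U => by
      dsimp only
      have := Real.add_one_le_exp (1 / 2 * β * ((r.N : ℝ) - WilsonRP.plaqRe r.ρ U (x, o)))
      linarith).trans h
  have hsplit : ∫ U, (1 + 1 / 2 * β * ((r.N : ℝ) - WilsonRP.plaqRe r.ρ U (x, o))) ∂μ =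
      1 + 1 / 2 * β * ∫ U, ((r.N : ℝ) - WilsonRP.plaqRe r.ρ U (x, o)) ∂μ := by
    rw [integral_add (integrable_const _) (hAint.const_mul _), integral_const, probReal_univ, one_smul,
      integral_const_mul]
  rw [hsplit] at hle
  rw [le_div_iff₀ hβpos]
  have : C * (1 / 2) = C / 2 := by ring
  rw [this] at hle
  nlinarith


end All

end Summit.QuantumFields.BalabanUV.T4Continuum.NE7b.LocalPlaquetteExpMoments

end
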